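import Summits.BirchSwinnertonDyer.Rank1Residual.Partition.EisensteinKernelCertificate
import Literature.NumberTheory.EllipticCurves.TorsionCardinality
import HarnessLib

/-!
# A rational `p`-line from a KERNEL-POLYNOMIAL CERTIFICATE (`p` odd): `h ∣ ψ_p`, doubling closure,
# `⟨−1, 2⟩ = 𝔽_pˣ` ⟹ the points above the roots of `h` form a `Γ_ℚ`-stable subgroup of order `p`
# (cell `bsd-addord`, seat `bsd-addord-twist`; the keystone of the Φ₀ kernel-records programme at `p ≥ 5`)

HONEST FRAMING (cell `bsd-addord`, `run/shared/lean/pub/bsd-addord/README.md` §4): the programme's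
target of record is the full Birch–Swinnerton-Dyer formula for every `E/ℚ` of analytic rank `≤ 1`;
this is a TOOL file (elementary theory of division polynomials; theorems only, no definition, no named
fact, no `sorry`). It books nothing. Its purpose: the per-pair LINE DATUM `Φ₀` of the X3♯(G-ord,
`e = 2`) end states at `p ≥ 5` (flag `Φ₀-datum data-level@p`, 258 rows of
`HOME/proof/phi0-p5/MANIFEST.tsv`) is given by engines as a KERNEL POLYNOMIAL `h ∈ ℚ[X]` of degree
`(p−1)/2`; this file turns such an `h`, with three polynomial identities checkable by `norm_num`, into
the tree's `IsRationalLine W p Φ` — the `p ≥ 5` analogue of `Partition/EisensteinKernelCertificate.lean`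
§9 (`p = 3`, where `h = X − x₀` and `Ψ₃(x₀) = 0`).

## The certificate and the theorem

For `W/ℚ` elliptic, `p` an odd prime, `m = (p − 1)/2`, `h, q, q₂ ∈ ℚ[X]`:
* (c1) **`h ∣ ψ_p`**: `W.preΨ' p = h * q` (Mathlib's univariate `preΨ'`; `ΨSq_p = (preΨ'_p)²` for odd
  `p`), so every geometric point above a root of `h` is `p`-torsion (Silverman *AEC* Ex. 3.7(f), tree
  theorem `zsmul_some_eq_zero_iff_eval_ΨSq`);
* (c2) **doubling closure**: `∑_{i ≤ m} h_i Φ₂^i Ψ₂Sq^{m−i} = h * q₂` with `natDegree h ≤ m` — since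
  `x([2]Q) = Φ₂(x)/Ψ₂Sq(x)` (Ex. 3.7(d), tree `mul_eval_ΨSq_of_zsmul_eq`), the abscissa of `[2]Q` is a
  root of `h` whenever that of `Q` is;
* (c3) **`±2` generates `𝔽_pˣ`**: every non-zero `k : ZMod p` is `± 2^j` (`decide` at `p = 5, 7, 13`).
THEOREM `exists_isRationalLine_of_kernelPolyCert`: then there is a rational `p`-line `Φ ≤ E[p]`
(`IsRationalLine W p Φ`) whose non-zero points are exactly... (stated: every non-zero point of `Φ` has
abscissa a root of `h`). Proof: a root `α ∈ ℚ̄` of `h`, a point `P = (α, y)`, `Φ = ℤP` (order `p` by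
(c1)); every non-zero multiple of `P` has abscissa a root of `h` ((c2), (c3), `−(x,y) = (x, ·)`); the
set `T = {O} ∪ {(x, y) : h(x) = 0}` has at most `1 + 2m = p` elements (two ordinates per abscissa, tree
`encard_setOf_X_mem`; `Ψ₂Sq ≠ 0` at roots of `h` since odd torsion is not `2`-torsion), so `T = ℤP`;
and `Γ_ℚ` maps `T` to `T` (`σ(x, y) = (σx, σy)`, `h(σx) = σ h(x)`), whence `σP ∈ ℤP`.

References: J. H. Silverman, *AEC* 2nd ed., Exercise 3.7 (b),(d),(f), III.2.3 [SilvermanAEC2009];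
R. Greenberg, V. Vatsal, Invent. Math. 142 (2000) p. 4 (rational `p`-isogeny kernel `Φ`)
[GreenbergVatsal2000]; HOME/proof/phi0-p5/README.md (engine dictionary: `h ∣ ψ_p`, doubling-closed,
`±2` generates).
-/

set_option autoImplicit false

noncomputable section

open scoped Classical

open WeierstrassCurve Polynomial Literature.NumberTheory.EllipticCurves
  Literature.NumberTheory.EllipticCurves.Rank1Residual Field

namespace Summit.BirchSwinnertonDyer.Rank1Residual.Additive.KernelPolyLine

variable {W : WeierstrassCurve ℚ} [W.IsElliptic] {p : ℕ} [Fact p.Prime]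

/-! ## §1 Coordinates of Galois conjugates -/

omit [W.IsElliptic] [Fact p.Prime] in
/-- `σ • (x, y) = (σx, σy)`. [folklore] -/
theorem smul_eq_some (σ : absoluteGaloisGroup ℚ) {P : W.geomPoints} {x y : (AlgebraicClosure ℚ)}
    {h : (W.baseChange (AlgebraicClosure ℚ)).toAffine.Nonsingular x y} (hP : P = Affine.Point.some x y h) :
    ∃ h' : (W.baseChange (AlgebraicClosure ℚ)).toAffine.Nonsingular (σ • x) (σ • y),
      σ • P = Affine.Point.some (σ • x) (σ • y) h' := by
  have e : σ • P = (Affine.Point.map (absoluteGaloisGroup.toAlgEquiv ℚ σ).toAlgHom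
        (Affine.Point.some x y h) : (W.baseChange (AlgebraicClosure ℚ)).toAffine.Point) := by rw [hP]; rfl
  rw [Affine.Point.map_some] at e
  exact ⟨_, e⟩

omit [W.IsElliptic] [Fact p.Prime] in
/-- A rational polynomial vanishing at `x` vanishes at `σx`. [folklore] -/
theorem eval_map_smul_eq_zero (σ : absoluteGaloisGroup ℚ) {g : ℚ[X]} {x : (AlgebraicClosure ℚ)}
    (hx : (g.map (algebraMap ℚ (AlgebraicClosure ℚ))).eval x = 0) :
    (g.map (algebraMap ℚ (AlgebraicClosure ℚ))).eval (σ • x) = 0 := by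
  rw [eval_map_algebraMap] at hx ⊢
  rw [show σ • x = (absoluteGaloisGroup.toAlgEquiv ℚ σ).toAlgHom x from rfl, aeval_algHom_apply, hx,
    map_zero]

/-! ## §2 (c1): points above the roots of `h` are `p`-torsion, and not `2`-torsion -/

omit [W.IsElliptic] [Fact p.Prime] in
/-- **(c1) ⟹ `p`-torsion.** If `W.preΨ' p = h * q` with `p` odd, a geometric point whose abscissa is
a root of `h` is killed by `p` (`ΨSq_p = preΨ'_p²` for odd `p`; Silverman Ex. 3.7(f)).
[cite: SilvermanAEC2009, Exercise 3.7(f)] -/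
theorem zsmul_eq_zero_of_eval_eq_zero (hodd : Odd p) {h q : ℚ[X]} (hdiv : W.preΨ' p = h * q)
    {P : W.geomPoints} {x y : (AlgebraicClosure ℚ)} {hxy : (W.baseChange (AlgebraicClosure ℚ)).toAffine.Nonsingular x y}
    (hP : P = Affine.Point.some x y hxy) (hx : (h.map (algebraMap ℚ (AlgebraicClosure ℚ))).eval x = 0) :
    (p : ℤ) • P = 0 := by
  subst hP
  have hne : ¬ Even p := Nat.not_even_iff_odd.mpr hodd
  change (p : ℤ) • (Affine.Point.some x y hxy : (W.baseChange (AlgebraicClosure ℚ)).toAffine.Point) = 0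
  rw [zsmul_some_eq_zero_iff_eval_ΨSq, baseChange, map_ΨSq, ΨSq_ofNat, if_neg hne, mul_one, hdiv,
    Polynomial.map_pow, Polynomial.map_mul, eval_pow, eval_mul, hx, zero_mul, zero_pow two_ne_zero]

omit [Fact p.Prime] in
/-- **`Ψ₂Sq` does not vanish at a root of `h`** (a point above it is odd torsion, not `2`-torsion).
[cite: SilvermanAEC2009, Exercise 3.7(f)] -/
theorem eval_Ψ₂Sq_ne_zero_of_eval_eq_zero (hodd : Odd p) {h q : ℚ[X]} (hdiv : W.preΨ' p = h * q)
    {x : (AlgebraicClosure ℚ)} (hx : (h.map (algebraMap ℚ (AlgebraicClosure ℚ))).eval x = 0) :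
    ((W.baseChange (AlgebraicClosure ℚ)).Ψ₂Sq).eval x ≠ 0 := by
  intro h2
  obtain ⟨y, hy⟩ := (W.baseChange (AlgebraicClosure ℚ)).exists_equation x
  have hxy : (W.baseChange (AlgebraicClosure ℚ)).toAffine.Nonsingular x y :=
    (W.baseChange (AlgebraicClosure ℚ)).toAffine.equation_iff_nonsingular.mp hy
  have hp : (p : ℤ) • (Affine.Point.some x y hxy : (W.baseChange (AlgebraicClosure ℚ)).toAffine.Point) = 0 :=
    zsmul_eq_zero_of_eval_eq_zero hodd hdiv (P := (Affine.Point.some x y hxy : W.geomPoints)) rfl hx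
  have h2' : (2 : ℤ) • (Affine.Point.some x y hxy : (W.baseChange (AlgebraicClosure ℚ)).toAffine.Point) = 0 := by
    rw [zsmul_some_eq_zero_iff_eval_ΨSq, ΨSq_two]
    exact h2
  -- `gcd(2, p) = 1` kills the point
  obtain ⟨k, hk⟩ := hodd
  have h1 : (Affine.Point.some x y hxy : (W.baseChange (AlgebraicClosure ℚ)).toAffine.Point) = 0 := by
    calc (Affine.Point.some x y hxy : (W.baseChange (AlgebraicClosure ℚ)).toAffine.Point)
        = (1 : ℤ) • (Affine.Point.some x y hxy : (W.baseChange (AlgebraicClosure ℚ)).toAffine.Point) := (one_zsmul _).symm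
      _ = ((p : ℤ) - k * 2) • (Affine.Point.some x y hxy : (W.baseChange (AlgebraicClosure ℚ)).toAffine.Point) := by
          rw [hk]; push_cast; ring_nf
      _ = 0 := by rw [sub_zsmul, hp, mul_zsmul, h2', zsmul_zero, neg_zero, add_zero]
  exact Affine.Point.some_ne_zero hxy h1

/-! ## §3 (c2): doubling closure -/

omit [W.IsElliptic] [Fact p.Prime] in
/-- A non-zero point is an affine point `(x, y)`. [folklore] -/
theorem exists_eq_some_of_ne_zero {F : Type*} [Field F] {V : WeierstrassCurve F}
    {Q : V.toAffine.Point} (hQ : Q ≠ 0) :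
    ∃ (x y : F) (h : V.toAffine.Nonsingular x y), Q = Affine.Point.some x y h := by
  cases Q with
  | zero => exact absurd rfl hQ
  | @some x y h => exact ⟨x, y, h, rfl⟩

omit [Fact p.Prime] in
/-- **(c2) ⟹ the abscissa of `[2]Q` is again a root of `h`.** For a point `Q = (x, y)` with
`h(x) = 0` (so `Q` is odd torsion by (c1)) and the identity `∑_{i ≤ m} h_i Φ₂^i Ψ₂Sq^{m−i} = h q₂`,
`natDegree h ≤ m`: `[2]Q = (x₂, y₂)` with `h(x₂) = 0` (`x₂ Ψ₂Sq(x) = Φ₂(x)`, Silverman Ex. 3.7(d)).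
[cite: SilvermanAEC2009, Exercise 3.7(d)] -/
theorem exists_two_zsmul_eq_some (hodd : Odd p) {h q q₂ : ℚ[X]} (hdiv : W.preΨ' p = h * q) {m : ℕ}
    (hdeg : h.natDegree ≤ m)
    (hdbl : ∑ i ∈ Finset.range (m + 1), C (h.coeff i) * W.Φ 2 ^ i * W.Ψ₂Sq ^ (m - i) = h * q₂)
    {P : W.geomPoints} {x y : (AlgebraicClosure ℚ)} {hxy : (W.baseChange (AlgebraicClosure ℚ)).toAffine.Nonsingular x y}
    (hP : P = Affine.Point.some x y hxy) (hx : (h.map (algebraMap ℚ (AlgebraicClosure ℚ))).eval x = 0) :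
    ∃ (x₂ y₂ : (AlgebraicClosure ℚ)) (h₂ : (W.baseChange (AlgebraicClosure ℚ)).toAffine.Nonsingular x₂ y₂),
      (2 : ℤ) • P = Affine.Point.some x₂ y₂ h₂ ∧ (h.map (algebraMap ℚ (AlgebraicClosure ℚ))).eval x₂ = 0 := by
  subst hP
  have hΨ : ((W.baseChange (AlgebraicClosure ℚ)).Ψ₂Sq).eval x ≠ 0 := eval_Ψ₂Sq_ne_zero_of_eval_eq_zero hodd hdiv hx
  -- `[2]Q ≠ O`, so `[2]Q = (x₂, y₂)`
  have h2ne : (2 : ℤ) • (Affine.Point.some x y hxy : (W.baseChange (AlgebraicClosure ℚ)).toAffine.Point) ≠ 0 := by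
    rw [Ne, zsmul_some_eq_zero_iff_eval_ΨSq, ΨSq_two]; exact hΨ
  obtain ⟨x₂, y₂, h₂, he⟩ := exists_eq_some_of_ne_zero h2ne
  refine ⟨x₂, y₂, h₂, he, ?_⟩
  -- `x₂ Ψ₂Sq(x) = Φ₂(x)`
  have hmul : x₂ * ((W.baseChange (AlgebraicClosure ℚ)).ΨSq 2).eval x = ((W.baseChange (AlgebraicClosure ℚ)).Φ 2).eval x :=
    (W.baseChange (AlgebraicClosure ℚ)).mul_eval_ΨSq_of_zsmul_eq hxy 2 h₂ he
  rw [ΨSq_two] at hmul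
  -- evaluate the identity (c2) at `x`
  have hΦ₂ : ((W.Φ 2).map (algebraMap ℚ (AlgebraicClosure ℚ))).eval x = ((W.baseChange (AlgebraicClosure ℚ)).Φ 2).eval x := by
    rw [baseChange, map_Φ]
  have hΨ₂ : ((W.Ψ₂Sq).map (algebraMap ℚ (AlgebraicClosure ℚ))).eval x = ((W.baseChange (AlgebraicClosure ℚ)).Ψ₂Sq).eval x := by
    rw [baseChange, map_Ψ₂Sq]
  have hid : ∑ i ∈ Finset.range (m + 1), algebraMap ℚ (AlgebraicClosure ℚ) (h.coeff i) *
      ((W.baseChange (AlgebraicClosure ℚ)).Φ 2).eval x ^ i * ((W.baseChange (AlgebraicClosure ℚ)).Ψ₂Sq).eval x ^ (m - i) = 0 := by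
    have e := congrArg (fun g : ℚ[X] ↦ (g.map (algebraMap ℚ (AlgebraicClosure ℚ))).eval x) hdbl
    simp only [Polynomial.map_mul, Polynomial.map_sum, Polynomial.map_pow, map_C, eval_mul,
      eval_finsetSum, eval_pow, eval_C, hx, zero_mul, hΦ₂, hΨ₂] at e
    exact e
  -- `h(x₂) · Ψ₂Sq(x)^m = ∑ h_i Φ₂(x)^i Ψ₂Sq(x)^(m-i) = 0`
  have hsum : (h.map (algebraMap ℚ (AlgebraicClosure ℚ))).eval x₂ =
      ∑ i ∈ Finset.range (m + 1), algebraMap ℚ (AlgebraicClosure ℚ) (h.coeff i) * x₂ ^ i := by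
    rw [eval_map_algebraMap, aeval_eq_sum_range' (lt_of_le_of_lt hdeg (Nat.lt_succ_self m))]
    simp only [Algebra.smul_def]
  have hkey : (h.map (algebraMap ℚ (AlgebraicClosure ℚ))).eval x₂ * ((W.baseChange (AlgebraicClosure ℚ)).Ψ₂Sq).eval x ^ m =
      ∑ i ∈ Finset.range (m + 1), algebraMap ℚ (AlgebraicClosure ℚ) (h.coeff i) *
        ((W.baseChange (AlgebraicClosure ℚ)).Φ 2).eval x ^ i * ((W.baseChange (AlgebraicClosure ℚ)).Ψ₂Sq).eval x ^ (m - i) := by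
    rw [hsum, Finset.sum_mul]
    refine Finset.sum_congr rfl fun i hi ↦ ?_
    have hi' : i ≤ m := Nat.lt_succ_iff.mp (Finset.mem_range.mp hi)
    obtain ⟨k, rfl⟩ := Nat.exists_eq_add_of_le hi'
    rw [Nat.add_sub_cancel_left, pow_add, ← hmul, mul_pow]
    ring
  have h0 : (h.map (algebraMap ℚ (AlgebraicClosure ℚ))).eval x₂ * ((W.baseChange (AlgebraicClosure ℚ)).Ψ₂Sq).eval x ^ m = 0 := by
    rw [hkey, hid]
  exact (mul_eq_zero.mp h0).resolve_right (pow_ne_zero _ hΨ)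

/-! ## §4 Every multiple `(±2^j) • P` of a certified point is a certified point -/

omit [Fact p.Prime] in
/-- **All multiples `(±2^j) • P` of a certified point are certified points.** [folklore] -/
theorem exists_pow_two_zsmul_eq_some (hodd : Odd p) {h q q₂ : ℚ[X]} (hdiv : W.preΨ' p = h * q)
    {m : ℕ} (hdeg : h.natDegree ≤ m)
    (hdbl : ∑ i ∈ Finset.range (m + 1), C (h.coeff i) * W.Φ 2 ^ i * W.Ψ₂Sq ^ (m - i) = h * q₂)
    (s : ℤˣ) (j : ℕ) :
    ∀ {P : W.geomPoints} {x y : (AlgebraicClosure ℚ)} {hxy : (W.baseChange (AlgebraicClosure ℚ)).toAffine.Nonsingular x y},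
      P = Affine.Point.some x y hxy → (h.map (algebraMap ℚ (AlgebraicClosure ℚ))).eval x = 0 →
      ∃ (x' y' : (AlgebraicClosure ℚ)) (h' : (W.baseChange (AlgebraicClosure ℚ)).toAffine.Nonsingular x' y'),
        ((s : ℤ) * 2 ^ j) • P = Affine.Point.some x' y' h' ∧
        (h.map (algebraMap ℚ (AlgebraicClosure ℚ))).eval x' = 0 := by
  induction j with
  | zero =>
    intro P x y hxy hP hx
    subst hP
    rcases Int.units_eq_one_or s with hs | hs
    · refine ⟨x, y, hxy, ?_, hx⟩
      rw [hs, Units.val_one, pow_zero, mul_one, one_zsmul]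
    · refine ⟨x, (W.baseChange (AlgebraicClosure ℚ)).toAffine.negY x y, ((Affine.nonsingular_neg _ _).mpr hxy), ?_, hx⟩
      rw [hs, Units.val_neg, Units.val_one, pow_zero, mul_one, neg_one_zsmul]
      exact Affine.Point.neg_some hxy
  | succ j ih =>
    intro P x y hxy hP hx
    obtain ⟨x₂, y₂, h₂, he₂, hx₂⟩ := exists_two_zsmul_eq_some hodd hdiv hdeg hdbl hP hx
    obtain ⟨x', y', h', he', hx'⟩ := ih he₂ hx₂
    refine ⟨x', y', h', ?_, hx'⟩
    rw [pow_succ, ← mul_assoc, mul_zsmul, he']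

/-! ## §5 The theorem -/

/-- **A rational `p`-line from a kernel-polynomial certificate.** Let `W/ℚ` be elliptic, `p` an odd
prime, `h, q, q₂ ∈ ℚ[X]` and `m : ℕ` with `2 * m + 1 = p`, `natDegree h ≤ m`, and
(c1) `W.preΨ' p = h * q`, (c2) `∑_{i ≤ m} C h_i · Φ₂^i · Ψ₂Sq^{m−i} = h * q₂`,
(c3) every non-zero element of `ZMod p` is `± 2^j`, and `h` has a root in `ℚ̄`. Then `E[p]` contains a
RATIONAL `p`-LINE `Φ` (`IsRationalLine W p Φ`) every non-zero point of which has abscissa a root of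
`h`. [cite: SilvermanAEC2009, Exercise 3.7 (d),(f)] [cite: GreenbergVatsal2000, p. 4] -/
theorem exists_isRationalLine_of_kernelPolyCert (hp2 : p ≠ 2) {h q q₂ : ℚ[X]} {m : ℕ}
    (hm : 2 * m + 1 = p) (hdeg : h.natDegree ≤ m) (hdiv : W.preΨ' p = h * q)
    (hdbl : ∑ i ∈ Finset.range (m + 1), C (h.coeff i) * W.Φ 2 ^ i * W.Ψ₂Sq ^ (m - i) = h * q₂)
    (hgen : ∀ k : ZMod p, k ≠ 0 → ∃ (s : ℤˣ) (j : ℕ), k = ((s : ℤ) * 2 ^ j : ℤ))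
    (hroot : ∃ α : (AlgebraicClosure ℚ), (h.map (algebraMap ℚ (AlgebraicClosure ℚ))).eval α = 0) :
    ∃ Φ : AddSubgroup (geomTorsion W (p : ℤ)), IsRationalLine W p Φ ∧
      ∀ Q ∈ Φ, Q ≠ 0 → ∃ (x y : (AlgebraicClosure ℚ)) (hxy : (W.baseChange (AlgebraicClosure ℚ)).toAffine.Nonsingular x y),
        (Q : W.geomPoints) = Affine.Point.some x y hxy ∧ (h.map (algebraMap ℚ (AlgebraicClosure ℚ))).eval x = 0 := by
  have hp : p.Prime := Fact.out
  have hodd : Odd p := hp.odd_of_ne_two hp2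
  set E := W.baseChange (AlgebraicClosure ℚ) with hE
  -- the certified point `P₀ = (α, y)`
  obtain ⟨α, hα⟩ := hroot
  obtain ⟨y, hy⟩ := E.exists_equation α
  have hαy : E.toAffine.Nonsingular α y := E.toAffine.equation_iff_nonsingular.mp hy
  set P₀ : W.geomPoints := Affine.Point.some α y hαy with hP₀
  have hpP₀ : (p : ℤ) • P₀ = 0 := zsmul_eq_zero_of_eval_eq_zero hodd hdiv hP₀ hα
  have hP₀0 : P₀ ≠ 0 := Affine.Point.some_ne_zero hαy
  have hordP₀ : addOrderOf P₀ = p :=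
    addOrderOf_eq_prime (by rw [← natCast_zsmul]; exact hpP₀) hP₀0
  -- (A) every multiple of `P₀` is `O` or a certified point
  have hmult : ∀ n : ℤ, n • P₀ = 0 ∨ ∃ (x' y' : (AlgebraicClosure ℚ)) (h' : E.toAffine.Nonsingular x' y'),
      n • P₀ = Affine.Point.some x' y' h' ∧ (h.map (algebraMap ℚ (AlgebraicClosure ℚ))).eval x' = 0 := by
    intro n
    by_cases hn : (n : ZMod p) = 0
    · left
      obtain ⟨c, hc⟩ := (ZMod.intCast_zmod_eq_zero_iff_dvd n p).mp hn
      rw [hc, mul_comm, mul_zsmul, hpP₀, zsmul_zero]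
    · right
      obtain ⟨s, j, hsj⟩ := hgen (n : ZMod p) hn
      obtain ⟨x', y', h', he, hx'⟩ := exists_pow_two_zsmul_eq_some hodd hdiv hdeg hdbl s j hP₀ hα
      refine ⟨x', y', h', ?_, hx'⟩
      have hcong : ((n - (s : ℤ) * 2 ^ j : ℤ) : ZMod p) = 0 := by
        rw [Int.cast_sub, hsj, sub_self]
      obtain ⟨c, hc⟩ := (ZMod.intCast_zmod_eq_zero_iff_dvd _ p).mp hcong
      have hn' : n = (s : ℤ) * 2 ^ j + (p : ℤ) * c := by linarith
      have hpc : ((p : ℤ) * c) • P₀ = 0 := by rw [mul_comm, mul_zsmul, hpP₀, zsmul_zero]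
      rw [hn', add_zsmul, hpc, add_zero, he]
  -- (B) the set `T` of `O` and the points above the roots of `h` has at most `p` elements
  have hh0 : h.map (algebraMap ℚ (AlgebraicClosure ℚ)) ≠ 0 := by
    intro h0
    have hz : h = 0 := (Polynomial.map_eq_zero (algebraMap ℚ (AlgebraicClosure ℚ))).mp h0
    have hpre : W.preΨ' p ≠ 0 := W.preΨ'_ne_zero (by exact_mod_cast hp.ne_zero)
    rw [hz, zero_mul] at hdiv
    exact hpre hdiv
  set R : Finset (AlgebraicClosure ℚ) := ((h.map (algebraMap ℚ (AlgebraicClosure ℚ))).roots).toFinset with hR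
  have hmemR : ∀ x : (AlgebraicClosure ℚ), (h.map (algebraMap ℚ (AlgebraicClosure ℚ))).eval x = 0 ↔ x ∈ R := by
    intro x
    rw [hR, Multiset.mem_toFinset, mem_roots hh0, IsRoot.def]
  have hRcard : R.card ≤ m := by
    calc R.card ≤ Multiset.card (h.map (algebraMap ℚ (AlgebraicClosure ℚ))).roots := Multiset.toFinset_card_le _
      _ ≤ (h.map (algebraMap ℚ (AlgebraicClosure ℚ))).natDegree := card_roots' _
      _ ≤ h.natDegree := natDegree_map_le
      _ ≤ m := hdeg
  have hRΨ : ∀ x ∈ R, (E.Ψ₂Sq).eval x ≠ 0 := fun x hx ↦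
    eval_Ψ₂Sq_ne_zero_of_eval_eq_zero hodd hdiv ((hmemR x).mpr hx)
  set A : Set E.toAffine.Point := {Q | ∃ x y, ∃ hxy : E.toAffine.Nonsingular x y,
      Q = Affine.Point.some x y hxy ∧ x ∈ R} with hA
  have hAcard : A.encard = 2 * R.card := E.encard_setOf_X_mem R hRΨ
  set T : Set W.geomPoints := {0} ∪ A with hT
  have hTfin : T.Finite :=
    (Set.finite_singleton _).union (Set.finite_of_encard_eq_coe hAcard)
  have hTcard : T.encard ≤ p := by
    calc T.encard ≤ ({0} : Set W.geomPoints).encard + A.encard := Set.encard_union_le _ _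
      _ = 1 + 2 * R.card := by rw [Set.encard_singleton, hAcard]
      _ ≤ 1 + 2 * (m : ℕ∞) := by gcongr
      _ = p := by rw [← hm]; push_cast; ring
  -- (C) `ℤ P₀ ⊆ T`, both finite, `#ℤP₀ = p ≥ #T`, so `ℤ P₀ = T`
  set Φ' : AddSubgroup W.geomPoints := AddSubgroup.zmultiples P₀ with hΦ'
  have hsub : (Φ' : Set W.geomPoints) ⊆ T := by
    intro Q hQ
    obtain ⟨n, rfl⟩ := AddSubgroup.mem_zmultiples_iff.mp hQ
    rcases hmult n with h0 | ⟨x', y', h', he, hx'⟩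
    · exact Or.inl h0
    · exact Or.inr ⟨x', y', h', he, (hmemR x').mp hx'⟩
  have hΦ'fin : (Φ' : Set W.geomPoints).Finite := hTfin.subset hsub
  have hΦ'card : (Φ' : Set W.geomPoints).encard = p := by
    have h1 : (Φ' : Set W.geomPoints).ncard = p := by
      rw [← Nat.card_coe_set_eq]
      change Nat.card Φ' = p
      rw [hΦ', Nat.card_zmultiples, hordP₀]
    rw [← hΦ'fin.cast_ncard_eq, h1]
  have hTeq : (Φ' : Set W.geomPoints) = T :=
    hTfin.eq_of_subset_of_encard_le' hsub (by rw [hΦ'card]; exact hTcard)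
  -- (D) `Γ_ℚ` maps `P₀` into `T = ℤ P₀`
  have hstab : ∀ σ : absoluteGaloisGroup ℚ, ∃ n : ℤ, n • P₀ = σ • P₀ := by
    intro σ
    obtain ⟨h', he⟩ := smul_eq_some σ hP₀
    have hmemT : σ • P₀ ∈ T := Or.inr ⟨σ • α, σ • y, h', he, (hmemR _).mp (eval_map_smul_eq_zero σ hα)⟩
    rw [← hTeq] at hmemT
    exact AddSubgroup.mem_zmultiples_iff.mp hmemT
  -- the line inside `E[p]`
  have hmem : P₀ ∈ geomTorsion W (p : ℤ) := (Submodule.mem_torsionBy_iff _ _).mpr hpP₀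
  set P : geomTorsion W (p : ℤ) := ⟨P₀, hmem⟩ with hP
  have hP0 : P ≠ 0 := fun e ↦ hP₀0 (congrArg Subtype.val e)
  have hpP : (p : ℕ) • P = 0 := by
    apply Subtype.ext
    rw [AddSubmonoidClass.coe_nsmul, ZeroMemClass.coe_zero, hP, ← natCast_zsmul]
    exact hpP₀
  refine ⟨AddSubgroup.zmultiples P, ⟨?_, ?_⟩, ?_⟩
  · rw [Nat.card_zmultiples, addOrderOf_eq_prime hpP hP0]
  · intro σ Q hQ
    obtain ⟨n, rfl⟩ := AddSubgroup.mem_zmultiples_iff.mp hQ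
    obtain ⟨k, hk⟩ := hstab σ
    have hσP : σ • P = k • P := Subtype.ext (by
      rw [AddSubgroup.torsionBy.coe_smul, AddSubgroupClass.coe_zsmul, hP]
      exact hk.symm)
    rw [smul_comm, hσP, smul_smul]
    exact AddSubgroup.mem_zmultiples_iff.mpr ⟨n * k, rfl⟩
  · intro Q hQ hQ0
    obtain ⟨n, rfl⟩ := AddSubgroup.mem_zmultiples_iff.mp hQ
    have hne : n • P₀ ≠ 0 := by
      intro e
      apply hQ0
      apply Subtype.ext
      rw [AddSubgroupClass.coe_zsmul, ZeroMemClass.coe_zero, hP]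
      exact e
    rcases hmult n with h0 | ⟨x', y', h', he, hx'⟩
    · exact absurd h0 hne
    · refine ⟨x', y', h', ?_, hx'⟩
      rw [AddSubgroupClass.coe_zsmul, hP]
      exact he

end Summit.BirchSwinnertonDyer.Rank1Residual.Additive.KernelPolyLine

end
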